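import Summits.QuantumFields.BalabanUV.Beta.D1BFx.PackedMultiplierColumnMass
import Summits.QuantumFields.BalabanUV.Beta.D1BFx.PackedMultiplierSlotLetters
import Summits.QuantumFields.BalabanUV.Beta.D1BFx.PackedStraightColumn

/-!
# `BalabanUV.Beta.D1BFx.PackedStraightColumnMixedMass` — road «BF-x» for binder row D1, slot (K), PART 24 letter «M-pack» AT THE CHART OF RECORD (α′), «K0-MIX-PACK» FILE C′:
# **THE (M-b) ROWS OF `vertexOfM K₀ n M` AND `mixOfK K₀ n M₂` AT THE STRAIGHT PIN `K₀ = KInvStep 3 n 0`, POWERS DISPLAYED** — the straight multiplier column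
# `colM K₀ n ν y′ ρ w = wΦ^{(n)} ρ ν (w − y′)` pays `(n⁵)⁻¹·(n³)⁻¹` per coarse slot (displayed letter `hΦ` = the SHAPE of d4-p3's level-uniform, unconditional
# `RemainderExplicitMultiplier.exists_wΦ_decay`), the straight `ℋ`-column `(n⁵)⁻¹` («K0-COL-ENV», g60 FILE A); NET `n⁻⁸` for `V^M`, `n⁻¹³ × (table count)` for `mixOfK`

HONEST DEPENDENCY (cell records, verbatim): «continuum YM on T⁴ ⇐ BetaPertH ∧ nine spine estimates (0/9 proved); BetaPertH ⇐ (D1) ∧ (D4) ∧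
CAP+tail; G-an2-4 gates asym, D1 and NE2/3/4.»  HONEST FRAMING (cell contract, verbatim): «discharging `BetaPertH` makes Bałaban's UV stability
UNCONDITIONAL — a real constructive-QFT result; it is NOT the continuum limit and NOT the Clay problem.»  THIS MODULE DISCHARGES NOTHING of the
wall: [folklore] `ℓ¹` bookkeeping BY NAME over LANDED objects (FILE A′ `PackedMultiplierColumnMass`, FILE B′ `PackedMultiplierSlotLetters`, g60 FILE A
`PackedStraightColumn.abs_colH_K₀_road_le` over g53's `PackedColumnEnvelope.abs_colH_KInvStep_zero_le`, gan24-leaf-12's `EnvelopeBlockSum.env_le_exp_l1`, lit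
`SecondOrderResponse.colM_KInv` ∕ `OneStepResolventKernel.KInv_inr_inr_coarse`, `BorderedHessian.KInvStep_zero_eq`; gan24-leaf-14's `GAN24.MultiplierZeroMass.colM_KInvStep` is the all-level twin).  The multiplier envelope `hΦ` is a DISPLAYED hypothesis —
discharged BY NAME at `n = Lc^{j+1}`, level-uniformly and unconditionally, by d4-p3's `RemainderExplicitMultiplier.exists_wΦ_decay` (NOT imported here: the mass files'
import closure stays free of the GAN24 strip chain; the consumer `obtain`s `⟨κ₀, CΦ, hκ₀, hCΦ, hΦ⟩` once).  No definition, no `def … : Prop`, nothing cited, 0 sorry.  Every table letter is a DISPLAYED hypothesis on an ARBITRARY family; NO (1.22) row is proved; per-word absolute-value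
letters are INTERMEDIATE lemmas (an2 R-D1-g45-4 (3): the END's closing step is the PAIRED second variation); 0 root-level binders of row D1 discharged (hW ∕ hR-sockets ∕
hSX-socket ∕ D1Tel ∕ D1Rep = 0); (J1) ONE OPEN ROW; (K) NOT closed; NOT D1, NEVER «G-an2-4 closed», NOT `BetaPertH`, NOT continuum, NOT Clay.

ABSOLUTE RULE (cell charter, verbatim): «No internally-minted statement may enter as a cited fact. Every hypothesis is either kernel-proved in
this package or a verbatim quotation of a PUBLISHED theorem with page reference. The manuscript(s) under audit are NOT citable for their own
disputed steps — they are the thing under adjudication; programme-internal (2001/route/tribunal) claims are never citable.»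

WHY.  The OWNER's PART 24-hyb HEAD (d1-p2 g24 `PART24-HEAD-SPEC-g24.v1_1.md`) displays, at the STRAIGHT pin `K₀ := KInvStep n 0` of the chart of record (α′), the smooth
mixed words `mixOfK K₀ n M₂ μ y ν y′ + mixOfK K₀ n M₂ ν y′ μ y` ((H3-lit) `W^s`, (H3-Δ)'s (D-R) rest) and `V^M := vertexOfM K₀ n (tabs.M 0)` ((H2-M)'s `W^{M}`); d1-leaf-01's TT16
`DressedMixVertexSplit` splits the dressed words into these straight words + gauge brackets.  «K0-MIX-PACK» = FILE A′ `PackedMultiplierColumnMass` (K-generic rows), FILE B′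
`PackedMultiplierSlotLetters` (slot letters from localisation), FILE C′ (this file: the straight pin, powers displayed).

CONTENT of FILE C′ (`d = 3`; `C₄ := MG163 4·periodConst (kappa163 4) 3`, `κ′ := kappa163 4 ∕ 4`, `m₀ := min κ′ κ₀`; block side `n`, `[NeZero n]`).
* §1 [folklore]: **`abs_colM_K₀_le_of_wΦ`** («K0-COLM-ENV»; `colM K₀ n ν y′ ρ w = wΦ^{(n)} ρ ν (w − y′)` by lit `colM_KInv` ∕ `KInvStep_zero_eq`, inlined: `hΦ` ⟹ `|colM K₀ n ν y′ ρ w| ≤ (CΦ·(n⁵)⁻¹·(n³)⁻¹·e^{κ₀})·e^{−(κ₀∕(4n))|n•w − n•y′|₁}`),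
  `colM_K₀_weight_nonneg`, **`mass_blk_vertexOfM_K₀_le`** («K0-MULT-MASS»: `σ ≤ κ₀∕(16n)` ⟹ `≤ ((n⁵)⁻¹·(n³)⁻¹)·(4·CΦ·e^{κ₀}·e^{κ₀∕2}·Zl 4 (κ₀∕8))·T j k` — `n⁻⁸` per coarse
  slot, ONE coarse slot per block), **`mass_blk_mixOfK_K₀_le`** («K0-MIX-MASS»: plain mass
  `≤ ((n⁵)⁻¹·((n⁵)⁻¹·(n³)⁻¹))·(16·C₄e^{κ′}·CΦe^{κ₀}·e^{m₀}·e^{m₀}·Zl 4 (m₀∕8)·Zl 4 (θ∕2))·T j i·e^{−min (m₀∕8) (θ∕2)·|y′ − y|₁}` from fine-block × coarse-slot totals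
  `≤ T j i·e^{−θ|w − y₁|₁}`), **`mass_blk_mixOfK_K₀_le_pow`** (`T := n^{p+13}·m̄` ⟹ power `n^p`: the two straight columns pay exactly `n⁻¹³`).
* §2 [folklore] the rows with the slot letters READ FROM THE TABLES' LOCALISATION (FILE B′): **`mass_blk_vertexOfM_K₀_le_of_vertexFamily`** (`VertexFamily M n C_M δ_M` ⟹
  `T j k := 16·C_M·Zl 4 (δ_M∕2)²`), **`mass_blk_mixOfK_K₀_le_of_locStencilFM`** (`LocStencilFM n M₂ C δ` ⟹ `T j i := n⁴·(16·C·Zl 4 (δ∕2)²·e^{4δ})`, `θ := δ` — NET `n⁻⁹`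
  against the table's localisation constant).
* §3 [folklore] R-T's letter SHAPE, literally (g60 FILE B §5's twin; `n = m + 1`, per-scale `hΦ m`, per-scale tables `M₂ n` with fine-block × coarse-slot totals
  `≤ n^{p+13}·m̄W·e^{−θ|w − y₁|₁}`): **`ffW_mixOfK_K₀_rows_pow`** (`Σ'_q Σ_{g f} |ffW (mixOfK (KInvStep 3 n 0) n (M₂ n)) μ 0 ν z q g f| ≤ (m+1)^p·(C^{mix}_{K₀}(θ)·m̄W)·e^{−min (m₀∕8) (θ∕2)|z|₁}`,
  summable — at `p = 2` LITERALLY `RestKernelSandwichScaled.exists_row_RkSand_tadpole_unit`'s `hWs ∕ hWm`), **`ffW_mixOfK_swap_K₀_rows_pow`** (the swapped word, same row),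
  `plainMass_blk_add_le`, **`ffW_mixOfK_symm_K₀_rows_pow`** (the HEAD's symmetrised family `mixOfK K₀ (M₂ n) μ y ν y′ + mixOfK K₀ (M₂ n) ν y′ μ y` AS DISPLAYED: constant `2·C^{mix}_{K₀}(θ)`).
NOT HERE (honest): the `∃`-packaging at `n = Lc^{j+1}` with `exists_wΦ_decay` (a corollary the consumer writes in three lines, or this lane on word); any localisation
letter of any ACTUAL table (an1's ∕ an2's — their constants' `n`-law is the table author's); the `dM∘K2OfK` response word; the brackets with `Λ` (`W^{M}`, leaf-01's O-2
currency); the tadpole against `G′` (an2's `CombChartResolventRules` envelope); any (1.22) row; the PAIRED second variation (the END's closing step).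
Unit `b2b-balaban-gan24-formalise-leaf-05` (gen 61), G-an2-4 swarm leaf prover 05, road «BF-x» supplier; INTENT-1 «K0-MIX-PACK» FILE C′ (journal [GAN24LEAF05-G61-INTENT-1] ∕ A-2 ∕ A-3: v1.2 = v1 + §3).
-/

noncomputable section

open Finset
open scoped BigOperators
open Literature.MathematicalPhysics.QuantumFieldTheory
open Literature.MathematicalPhysics.QuantumFieldTheory.LatticeForm (quo)
open Literature.MathematicalPhysics.QuantumFieldTheory.Balaban1983to89
open Literature.MathematicalPhysics.QuantumFieldTheory.Balaban1983to89.Beta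
open B12Sec2to5 (l1 l1_nonneg)
open B4ContourShift (supNorm)
open B5Hk163Strip (kappa163 kappa163_pos)
open B5Hk163Decay (MG163)
open B4TorusKernel (periodConst)
open ExpKernelCalculus (Site MKer Zl Zl_pos Zl_nonneg l1_natSmul)
open AffineAveraging (box toSite)
open KernelSpecInstance (wΦ)
open OneStepResolventKernel (Fib wsum KInv_inr_inr_coarse quo_zsmul)
open OneStepKernelFamily (colH KInvStep vertexOfK)
open SecondOrderResponse (colM vertexOfM mixOfK)
open Summit.QuantumFields.BalabanUV.Beta.BorderedHessian (KInvStep_zero_eq)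
open Summit.QuantumFields.BalabanUV.Beta.D1BFx.PackedKernelSplit (blk ffW ffW_apply)
open Summit.QuantumFields.BalabanUV.Beta.GAN24.EnvelopeBlockSum (env_le_exp_l1)
open Summit.QuantumFields.BalabanUV.Beta.D1BFx.PackedStraightColumn (abs_colH_K₀_road_le colH_K₀_road_weight_nonneg)
open Summit.QuantumFields.BalabanUV.Beta.D1BFx.PackedMultiplierColumnMass (mass_blk_vertexOfM_le_of_slotMass mass_blk_mixOfK_le_of_blockSlotTotal)
open Summit.QuantumFields.BalabanUV.Beta.D1BFx.PackedMultiplierSlotLetters (slotMass_le_of_vertexFamily blockSlotTotal_le_of_locStencilFM)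

namespace Summit.QuantumFields.BalabanUV.Beta.D1BFx.PackedStraightColumnMixedMass

/-! ## §1 The STRAIGHT pin `K₀ = KInvStep 3 n 0` (any `n`, `[NeZero n]`): the multiplier column is `wΦ^{(n)}`; the rows with the powers displayed -/

section Straight

variable (n : ℕ) [NeZero n]

/-- [folklore] **«K0-COLM-ENV»**: a displayed block-scale envelope of the multiplier-response kernel `|wΦ^{(n)} ρ ν w| ≤ CΦ·(n⁵)⁻¹·(n³)⁻¹·e^{−κ₀‖w‖∞}` (`0 ≤ κ₀`; the
SHAPE of d4-p3's level-uniform `RemainderExplicitMultiplier.exists_wΦ_decay` at `n = Lc^{j+1}`) gives the straight multiplier column's envelope in the road's fine `ℓ¹`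
currency: `|colM (KInvStep 3 n 0) n ν y′ ρ w| ≤ (CΦ·(n⁵)⁻¹·(n³)⁻¹·e^{κ₀})·e^{−(κ₀∕(4n))·|n•w − n•y′|₁}` (`EnvelopeBlockSum.env_le_exp_l1` at the coarse point). -/
theorem abs_colM_K₀_le_of_wΦ {CΦ κ₀ : ℝ} (hκ₀ : 0 ≤ κ₀)
    (hΦ : ∀ (ρ ν : Fin (3 + 1)) (w : Fin (3 + 1) → ℤ),
      |wΦ (N := n) ρ ν w| ≤ CΦ * ((n : ℝ) ^ 5)⁻¹ * ((n : ℝ) ^ 3)⁻¹ * Real.exp (-(κ₀ * supNorm w)))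
    (ν : Fin (3 + 1)) (y' : Fin (3 + 1) → ℤ) (ρ : Fin (3 + 1)) (w : Fin (3 + 1) → ℤ) :
    |colM (KInvStep (d := 3) n 0) n ν y' ρ w|
      ≤ (CΦ * ((n : ℝ) ^ 5)⁻¹ * ((n : ℝ) ^ 3)⁻¹ * Real.exp κ₀)
        * Real.exp (-(κ₀ / (4 * (n : ℝ))) * l1 ((n : ℤ) • w - (n : ℤ) • y')) := by
  have hN : 1 ≤ n := Nat.one_le_iff_ne_zero.mpr (NeZero.ne n)
  -- the straight multiplier column IS the multiplier-response kernel: `colM K₀ n ν y′ ρ w = wΦ^{(n)} ρ ν (w − y′)` (lit `colM_KInv` after `KInvStep_zero_eq`;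
  -- gan24-leaf-14's `GAN24.MultiplierZeroMass.colM_KInvStep` is the all-level form at `N := Lc^{j+1}`)
  have e : colM (KInvStep (d := 3) n 0) n ν y' ρ w = wΦ (N := n) ρ ν (w - y') := by
    unfold SecondOrderResponse.colM
    rw [KInvStep_zero_eq, KInv_inr_inr_coarse]
  rw [e]
  have h := hΦ ρ ν (w - y')
  have hC : 0 ≤ CΦ * ((n : ℝ) ^ 5)⁻¹ * ((n : ℝ) ^ 3)⁻¹ := by
    have h0 := (abs_nonneg _).trans (hΦ 0 0 0)
    have e0 : supNorm (0 : Fin (3 + 1) → ℤ) = 0 := by simp [B4ContourShift.supNorm]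
    rw [e0, mul_zero, neg_zero, Real.exp_zero, mul_one] at h0
    exact h0
  have he := env_le_exp_l1 (d := 3) hN hκ₀ y' ((n : ℤ) • w)
  rw [quo_zsmul] at he
  refine (h.trans (mul_le_mul_of_nonneg_left he hC)).trans_eq ?_
  have e3 : ((3 : ℕ) : ℝ) + 1 = 4 := by norm_num
  simp only [e3]
  ring

/-- [folklore] The straight multiplier column's weight constant is nonnegative (for the `hCM` slots of §1). -/
theorem colM_K₀_weight_nonneg {CΦ κ₀ : ℝ}
    (hΦ : ∀ (ρ ν : Fin (3 + 1)) (w : Fin (3 + 1) → ℤ),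
      |wΦ (N := n) ρ ν w| ≤ CΦ * ((n : ℝ) ^ 5)⁻¹ * ((n : ℝ) ^ 3)⁻¹ * Real.exp (-(κ₀ * supNorm w))) :
    0 ≤ CΦ * ((n : ℝ) ^ 5)⁻¹ * ((n : ℝ) ^ 3)⁻¹ * Real.exp κ₀ := by
  have h0 := (abs_nonneg _).trans (hΦ 0 0 0)
  have e0 : supNorm (0 : Fin (3 + 1) → ℤ) = 0 := by simp [B4ContourShift.supNorm]
  rw [e0, mul_zero, neg_zero, Real.exp_zero, mul_one] at h0
  exact mul_nonneg h0 (Real.exp_pos _).le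

/-- [folklore] **«K0-MULT-MASS» — THE (M-b) ROW OF THE MULTIPLIER-COLUMN VERTEX AT THE STRAIGHT PIN, POWER DISPLAYED**: under the displayed multiplier envelope `hΦ`
(`0 < κ₀`), for `0 ≤ σ ≤ κ₀∕(16n)` and a multiplier table `M ρ w` whose blocks have summable `n•w`-centred `σ`-weighted masses UNIFORMLY `≤ T j k`, every block of
`vertexOfM (KInvStep 3 n 0) n M ν y′` has centred weighted mass at `n•y′`, rate `σ`, summable and `≤ ((n⁵)⁻¹·(n³)⁻¹)·(4·CΦ·e^{κ₀}·e^{κ₀∕2}·Zl 4 (κ₀∕8))·T j k` — the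
multiplier column pays `n⁻⁸` per coarse slot and there is ONE coarse slot per block (no `n⁴`).  The `V^M := vertexOfM K₀ n (tabs.M 0)` of the HEAD's `W^{M}`. -/
theorem mass_blk_vertexOfM_K₀_le {CΦ κ₀ : ℝ} (hκ₀ : 0 < κ₀)
    (hΦ : ∀ (ρ ν : Fin (3 + 1)) (w : Fin (3 + 1) → ℤ),
      |wΦ (N := n) ρ ν w| ≤ CΦ * ((n : ℝ) ^ 5)⁻¹ * ((n : ℝ) ^ 3)⁻¹ * Real.exp (-(κ₀ * supNorm w)))
    {M : Fin (3 + 1) → (Fin (3 + 1) → ℤ) → MKer 4 (Fib 3)} {σ : ℝ} {T : Bool → Bool → ℝ}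
    (hσ0 : 0 ≤ σ) (hσ : σ ≤ κ₀ / (16 * (n : ℝ))) (ν : Fin (3 + 1)) (y' : Fin (3 + 1) → ℤ)
    (hMs : ∀ ρ' w j k, Summable fun p : Site 4 × Site 4 =>
      ∑ g, ∑ f, |blk (M ρ' w) j k p.1 p.2 g f| * Real.exp (σ * (l1 (p.1 - (n : ℤ) • w) + l1 (p.2 - (n : ℤ) • w))))
    (hMm : ∀ ρ' w j k, ∑' p : Site 4 × Site 4,
      ∑ g, ∑ f, |blk (M ρ' w) j k p.1 p.2 g f| * Real.exp (σ * (l1 (p.1 - (n : ℤ) • w) + l1 (p.2 - (n : ℤ) • w))) ≤ T j k)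
    (j k : Bool) :
    (Summable fun p : Site 4 × Site 4 => ∑ g, ∑ f,
        |blk (vertexOfM (KInvStep (d := 3) n 0) n M ν y') j k p.1 p.2 g f|
          * Real.exp (σ * (l1 (p.1 - (n : ℤ) • y') + l1 (p.2 - (n : ℤ) • y')))) ∧
      ∑' p : Site 4 × Site 4, ∑ g, ∑ f,
          |blk (vertexOfM (KInvStep (d := 3) n 0) n M ν y') j k p.1 p.2 g f|
            * Real.exp (σ * (l1 (p.1 - (n : ℤ) • y') + l1 (p.2 - (n : ℤ) • y')))
        ≤ (((n : ℝ) ^ 5)⁻¹ * ((n : ℝ) ^ 3)⁻¹) * (4 * CΦ * Real.exp κ₀ * Real.exp (κ₀ / 2) * Zl 4 (κ₀ / 8)) * T j k := by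
  have hn0 : (0 : ℝ) < (n : ℝ) := by exact_mod_cast Nat.pos_of_ne_zero (NeZero.ne n)
  set aa : ℝ := κ₀ / (4 * (n : ℝ)) with haa
  have haa0 : 0 < aa := by positivity
  have hσ' : σ ≤ aa / 4 := by
    refine hσ.trans (le_of_eq ?_)
    rw [haa]; field_simp; ring
  obtain ⟨hs, hb⟩ := mass_blk_vertexOfM_le_of_slotMass (KInvStep (d := 3) n 0) n haa0 (colM_K₀_weight_nonneg n hΦ) hσ0 hσ' ν y'
    (fun ρ' w => abs_colM_K₀_le_of_wΦ n hκ₀.le hΦ ν y' ρ' w) hMs hMm j k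
  refine ⟨hs, hb.trans (le_of_eq ?_)⟩
  have e1 : 2 * aa * (n : ℝ) = κ₀ / 2 := by rw [haa]; field_simp; ring
  have e2 : aa * (n : ℝ) / 2 = κ₀ / 8 := by rw [haa]; field_simp; ring
  rw [e1, e2]
  ring

/-- [folklore] **«K0-MIX-MASS» — THE (M-b) ROW OF THE MIXED PAIR VERTEX AT THE STRAIGHT PIN, POWERS DISPLAYED**: under the displayed multiplier envelope `hΦ` (`0 < κ₀`),
with `m₀ := min κ′ κ₀` (`κ′ = kappa163 4 ∕ 4`, `C₄ = MG163 4·periodConst (kappa163 4) 3`), per-slot-pair summable plain block masses of the field–multiplier table `M₂`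
and FINE-BLOCK × COARSE-SLOT totals `Σ_{b ∈ box 4 n} Σ'|blk (M₂ κ (n•y₁ + b) ρ′ w) j i| ≤ T j i·e^{−θ|w − y₁|₁}` (`0 < θ`), every block of `mixOfK (KInvStep 3 n 0) n M₂ μ y ν y′`
has summable plain mass `≤ ((n⁵)⁻¹·((n⁵)⁻¹·(n³)⁻¹))·(16·(C₄e^{κ′})·(CΦe^{κ₀})·e^{m₀}·e^{m₀}·Zl 4 (m₀∕8)·Zl 4 (θ∕2))·T j i·e^{−min (m₀∕8) (θ∕2)·|y′ − y|₁}` — ONE straight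
`ℋ`-column (`n⁻⁵`, «K0-COL-ENV» FILE A) and ONE straight multiplier column (`n⁻⁸`) against the table author's count `T j i`; both envelopes weakened to the common
fine rate `m₀∕(4n)`.  The `mixOfK K₀ n M₂ + swap` of the HEAD's (D-R) rest. -/
theorem mass_blk_mixOfK_K₀_le {CΦ κ₀ : ℝ} (hκ₀ : 0 < κ₀)
    (hΦ : ∀ (ρ ν : Fin (3 + 1)) (w : Fin (3 + 1) → ℤ),
      |wΦ (N := n) ρ ν w| ≤ CΦ * ((n : ℝ) ^ 5)⁻¹ * ((n : ℝ) ^ 3)⁻¹ * Real.exp (-(κ₀ * supNorm w)))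
    {M₂ : Fin (3 + 1) → (Fin (3 + 1) → ℤ) → Fin (3 + 1) → (Fin (3 + 1) → ℤ) → MKer 4 (Fib 3)} {θ : ℝ} {T : Bool → Bool → ℝ} (hθ : 0 < θ)
    (hPs : ∀ κ u ρ' w j i, Summable fun p : Site 4 × Site 4 => ∑ g, ∑ f, |blk (M₂ κ u ρ' w) j i p.1 p.2 g f|)
    (hPB : ∀ (κ ρ' : Fin (3 + 1)) (y₁ w : Fin (3 + 1) → ℤ) (j i : Bool), ∑ b ∈ box (3 + 1) n,
      (∑' p : Site 4 × Site 4, ∑ g, ∑ f, |blk (M₂ κ ((n : ℤ) • y₁ + toSite b) ρ' w) j i p.1 p.2 g f|)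
        ≤ T j i * Real.exp (-θ * l1 (w - y₁)))
    (μ : Fin (3 + 1)) (y : Fin (3 + 1) → ℤ) (ν : Fin (3 + 1)) (y' : Fin (3 + 1) → ℤ) (j i : Bool) :
    (Summable fun p : Site 4 × Site 4 => ∑ g, ∑ f, |blk (mixOfK (KInvStep (d := 3) n 0) n M₂ μ y ν y') j i p.1 p.2 g f|) ∧
      ∑' p : Site 4 × Site 4, ∑ g, ∑ f, |blk (mixOfK (KInvStep (d := 3) n 0) n M₂ μ y ν y') j i p.1 p.2 g f|
        ≤ (((n : ℝ) ^ 5)⁻¹ * (((n : ℝ) ^ 5)⁻¹ * ((n : ℝ) ^ 3)⁻¹))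
          * (16 * ((MG163 4 * periodConst (kappa163 4) 3) * Real.exp (kappa163 4 / 4)) * (CΦ * Real.exp κ₀)
              * Real.exp (min (kappa163 4 / 4) κ₀) * Real.exp (min (kappa163 4 / 4) κ₀)
              * Zl 4 (min (kappa163 4 / 4) κ₀ / 8) * Zl 4 (θ / 2))
          * T j i * Real.exp (-(min (min (kappa163 4 / 4) κ₀ / 8) (θ / 2)) * l1 (y' - y)) := by
  have hn0 : (0 : ℝ) < (n : ℝ) := by exact_mod_cast Nat.pos_of_ne_zero (NeZero.ne n)
  have hκ' : 0 < kappa163 4 / 4 := div_pos (kappa163_pos 4) (by norm_num)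
  set m₀ : ℝ := min (kappa163 4 / 4) κ₀ with hm₀
  have hm₀0 : 0 < m₀ := lt_min hκ' hκ₀
  set a : ℝ := m₀ / (4 * (n : ℝ)) with ha
  have ha0 : 0 < a := by positivity
  -- both envelopes weakened to the common fine rate `a = m₀∕(4n)`
  have hweak : ∀ {c : ℝ} (_ : m₀ ≤ c) (l : ℝ), 0 ≤ l → Real.exp (-(c / (4 * (n : ℝ))) * l) ≤ Real.exp (-a * l) := by
    intro c hc l hl
    refine Real.exp_le_exp.2 ?_
    rw [ha]
    have : m₀ / (4 * (n : ℝ)) ≤ c / (4 * (n : ℝ)) := div_le_div_of_nonneg_right hc (by positivity)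
    nlinarith
  have hcolH : ∀ κ u, |colH (KInvStep (d := 3) n 0) n μ y κ u|
      ≤ (((n : ℝ) ^ 5)⁻¹ * ((MG163 4 * periodConst (kappa163 4) 3) * Real.exp (kappa163 4 / 4))) * Real.exp (-a * l1 (u - (n : ℤ) • y)) :=
    fun κ u => (abs_colH_K₀_road_le n μ y κ u).trans
      (mul_le_mul_of_nonneg_left (hweak (min_le_left _ _) _ (l1_nonneg _)) (colH_K₀_road_weight_nonneg n))
  have hcolM : ∀ ρ' w, |colM (KInvStep (d := 3) n 0) n ν y' ρ' w|
      ≤ (CΦ * ((n : ℝ) ^ 5)⁻¹ * ((n : ℝ) ^ 3)⁻¹ * Real.exp κ₀) * Real.exp (-a * l1 ((n : ℤ) • w - (n : ℤ) • y')) :=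
    fun ρ' w => (abs_colM_K₀_le_of_wΦ n hκ₀.le hΦ ν y' ρ' w).trans
      (mul_le_mul_of_nonneg_left (hweak (min_le_right _ _) _ (l1_nonneg _)) (colM_K₀_weight_nonneg n hΦ))
  obtain ⟨hs, hb⟩ := mass_blk_mixOfK_le_of_blockSlotTotal (KInvStep (d := 3) n 0) n ha0 hθ (colH_K₀_road_weight_nonneg n)
    (colM_K₀_weight_nonneg n hΦ) μ y ν y' hcolH hcolM hPs hPB j i
  refine ⟨hs, hb.trans (le_of_eq ?_)⟩
  have e1 : a * (4 : ℝ) * (n : ℝ) = m₀ := by rw [ha]; field_simp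
  have e2 : a * (n : ℝ) / 2 = m₀ / 8 := by rw [ha]; field_simp; ring
  rw [e1, e2]
  ring

/-- [folklore] **THE SAME ROW, THE TABLE's POWER FREE** (R-T's reading): fine-block × coarse-slot totals `≤ n^{p+13}·m̄ j i·e^{−θ|w − y₁|₁}` (any `p : ℕ` — the table
author's count) give every block of `mixOfK (KInvStep 3 n 0) n M₂ μ y ν y′` plain mass `≤ n^p·(16·C₄e^{κ′}·CΦe^{κ₀}·e^{m₀}·e^{m₀}·Zl 4 (m₀∕8)·Zl 4 (θ∕2))·m̄ j i·e^{−min (m₀∕8) (θ∕2)|y′−y|₁}`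
— the two straight columns pay exactly `n⁻¹³`. -/
theorem mass_blk_mixOfK_K₀_le_pow {CΦ κ₀ : ℝ} (hκ₀ : 0 < κ₀)
    (hΦ : ∀ (ρ ν : Fin (3 + 1)) (w : Fin (3 + 1) → ℤ),
      |wΦ (N := n) ρ ν w| ≤ CΦ * ((n : ℝ) ^ 5)⁻¹ * ((n : ℝ) ^ 3)⁻¹ * Real.exp (-(κ₀ * supNorm w)))
    (p : ℕ) {M₂ : Fin (3 + 1) → (Fin (3 + 1) → ℤ) → Fin (3 + 1) → (Fin (3 + 1) → ℤ) → MKer 4 (Fib 3)} {θ : ℝ} {mB : Bool → Bool → ℝ} (hθ : 0 < θ)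
    (hPs : ∀ κ u ρ' w j i, Summable fun p : Site 4 × Site 4 => ∑ g, ∑ f, |blk (M₂ κ u ρ' w) j i p.1 p.2 g f|)
    (hPB : ∀ (κ ρ' : Fin (3 + 1)) (y₁ w : Fin (3 + 1) → ℤ) (j i : Bool), ∑ b ∈ box (3 + 1) n,
      (∑' q : Site 4 × Site 4, ∑ g, ∑ f, |blk (M₂ κ ((n : ℤ) • y₁ + toSite b) ρ' w) j i q.1 q.2 g f|)
        ≤ ((n : ℝ) ^ (p + 13) * mB j i) * Real.exp (-θ * l1 (w - y₁)))
    (μ : Fin (3 + 1)) (y : Fin (3 + 1) → ℤ) (ν : Fin (3 + 1)) (y' : Fin (3 + 1) → ℤ) (j i : Bool) :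
    (Summable fun q : Site 4 × Site 4 => ∑ g, ∑ f, |blk (mixOfK (KInvStep (d := 3) n 0) n M₂ μ y ν y') j i q.1 q.2 g f|) ∧
      ∑' q : Site 4 × Site 4, ∑ g, ∑ f, |blk (mixOfK (KInvStep (d := 3) n 0) n M₂ μ y ν y') j i q.1 q.2 g f|
        ≤ (n : ℝ) ^ p
          * (16 * ((MG163 4 * periodConst (kappa163 4) 3) * Real.exp (kappa163 4 / 4)) * (CΦ * Real.exp κ₀)
              * Real.exp (min (kappa163 4 / 4) κ₀) * Real.exp (min (kappa163 4 / 4) κ₀)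
              * Zl 4 (min (kappa163 4 / 4) κ₀ / 8) * Zl 4 (θ / 2))
          * mB j i * Real.exp (-(min (min (kappa163 4 / 4) κ₀ / 8) (θ / 2)) * l1 (y' - y)) := by
  have hn0 : (0 : ℝ) < (n : ℝ) := by exact_mod_cast Nat.pos_of_ne_zero (NeZero.ne n)
  obtain ⟨hs, hb⟩ := mass_blk_mixOfK_K₀_le n hκ₀ hΦ (T := fun j i => (n : ℝ) ^ (p + 13) * mB j i) hθ hPs hPB μ y ν y' j i
  refine ⟨hs, hb.trans (le_of_eq ?_)⟩
  have hn : (n : ℝ) ≠ 0 := hn0.ne'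
  field_simp
  ring


/-! ## §2 The same rows with the slot letters READ FROM THE TABLES' LOCALISATION (FILE B′): the shapes the HEAD instantiates at the record -/

/-- [folklore] **«K0-MULT-MASS» FROM A `VertexFamily` LETTER**: under `hΦ` (`0 < κ₀`), a multiplier table with `VertexFamily M n C_M δ_M` (`0 < δ_M`) gives, for
`0 ≤ σ ≤ κ₀∕(16n)` and `σ ≤ δ_M∕2`, every block of `vertexOfM (KInvStep 3 n 0) n M ν y′` a centred weighted mass at `n•y′`
`≤ ((n⁵)⁻¹·(n³)⁻¹)·(4·CΦ·e^{κ₀}·e^{κ₀∕2}·Zl 4 (κ₀∕8))·(16·C_M·Zl 4 (δ_M∕2)²)` — the `V^M := vertexOfM K₀ n (tabs.M 0)` of the HEAD's `W^{M}` once an1's table letter is named. -/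
theorem mass_blk_vertexOfM_K₀_le_of_vertexFamily {CΦ κ₀ : ℝ} (hκ₀ : 0 < κ₀)
    (hΦ : ∀ (ρ ν : Fin (3 + 1)) (w : Fin (3 + 1) → ℤ),
      |wΦ (N := n) ρ ν w| ≤ CΦ * ((n : ℝ) ^ 5)⁻¹ * ((n : ℝ) ^ 3)⁻¹ * Real.exp (-(κ₀ * supNorm w)))
    {M : Fin (3 + 1) → (Fin (3 + 1) → ℤ) → MKer 4 (Fib 3)} {CM δM σ : ℝ} (hM : ExpKernelCalculus.VertexFamily M n CM δM) (hδM : 0 < δM)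
    (hσ0 : 0 ≤ σ) (hσ : σ ≤ κ₀ / (16 * (n : ℝ))) (hσM : σ ≤ δM / 2) (ν : Fin (3 + 1)) (y' : Fin (3 + 1) → ℤ) (j k : Bool) :
    (Summable fun p : Site 4 × Site 4 => ∑ g, ∑ f,
        |blk (vertexOfM (KInvStep (d := 3) n 0) n M ν y') j k p.1 p.2 g f|
          * Real.exp (σ * (l1 (p.1 - (n : ℤ) • y') + l1 (p.2 - (n : ℤ) • y')))) ∧
      ∑' p : Site 4 × Site 4, ∑ g, ∑ f,
          |blk (vertexOfM (KInvStep (d := 3) n 0) n M ν y') j k p.1 p.2 g f|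
            * Real.exp (σ * (l1 (p.1 - (n : ℤ) • y') + l1 (p.2 - (n : ℤ) • y')))
        ≤ (((n : ℝ) ^ 5)⁻¹ * ((n : ℝ) ^ 3)⁻¹) * (4 * CΦ * Real.exp κ₀ * Real.exp (κ₀ / 2) * Zl 4 (κ₀ / 8)) * (16 * CM * Zl 4 (δM / 2) ^ 2) :=
  mass_blk_vertexOfM_K₀_le n hκ₀ hΦ (T := fun _ _ => 16 * CM * Zl 4 (δM / 2) ^ 2) hσ0 hσ ν y'
    (fun ρ' w j k => (slotMass_le_of_vertexFamily n hM hδM hσM ρ' w j k).1)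
    (fun ρ' w j k => (slotMass_le_of_vertexFamily n hM hδM hσM ρ' w j k).2) j k

/-- [folklore] **«K0-MIX-MASS» FROM A `LocStencilFM` LETTER**: under `hΦ` (`0 < κ₀`), a mixed table with `LocStencilFM n M₂ C δ` (`0 < δ`; the SHAPE of
`CombHId2W2Record.exists_locStencilFM_M2comb`) gives every block of `mixOfK (KInvStep 3 n 0) n M₂ μ y ν y′` a summable plain mass
`≤ ((n⁵)⁻¹·((n⁵)⁻¹·(n³)⁻¹))·(16·C₄e^{κ′}·CΦe^{κ₀}·e^{m₀}·e^{m₀}·Zl 4 (m₀∕8)·Zl 4 (δ∕2))·(n⁴·(16·C·Zl 4 (δ∕2)²·e^{4δ}))·e^{−min (m₀∕8) (δ∕2)·|y′ − y|₁}` (`m₀ := min κ′ κ₀`) —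
NET POWER `n⁻⁹` against the table's localisation constant: the `mixOfK K₀ n M₂ + swap` of the HEAD's (D-R) rest once an1 ∕ an2's table letter is named. -/
theorem mass_blk_mixOfK_K₀_le_of_locStencilFM {CΦ κ₀ : ℝ} (hκ₀ : 0 < κ₀)
    (hΦ : ∀ (ρ ν : Fin (3 + 1)) (w : Fin (3 + 1) → ℤ),
      |wΦ (N := n) ρ ν w| ≤ CΦ * ((n : ℝ) ^ 5)⁻¹ * ((n : ℝ) ^ 3)⁻¹ * Real.exp (-(κ₀ * supNorm w)))
    {M₂ : Fin (3 + 1) → (Fin (3 + 1) → ℤ) → Fin (3 + 1) → (Fin (3 + 1) → ℤ) → MKer 4 (Fib 3)} {C δ : ℝ}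
    (hM : SecondOrderResponse.LocStencilFM n M₂ C δ) (hδ : 0 < δ)
    (μ : Fin (3 + 1)) (y : Fin (3 + 1) → ℤ) (ν : Fin (3 + 1)) (y' : Fin (3 + 1) → ℤ) (j i : Bool) :
    (Summable fun p : Site 4 × Site 4 => ∑ g, ∑ f, |blk (mixOfK (KInvStep (d := 3) n 0) n M₂ μ y ν y') j i p.1 p.2 g f|) ∧
      ∑' p : Site 4 × Site 4, ∑ g, ∑ f, |blk (mixOfK (KInvStep (d := 3) n 0) n M₂ μ y ν y') j i p.1 p.2 g f|
        ≤ (((n : ℝ) ^ 5)⁻¹ * (((n : ℝ) ^ 5)⁻¹ * ((n : ℝ) ^ 3)⁻¹))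
          * (16 * ((MG163 4 * periodConst (kappa163 4) 3) * Real.exp (kappa163 4 / 4)) * (CΦ * Real.exp κ₀)
              * Real.exp (min (kappa163 4 / 4) κ₀) * Real.exp (min (kappa163 4 / 4) κ₀)
              * Zl 4 (min (kappa163 4 / 4) κ₀ / 8) * Zl 4 (δ / 2))
          * ((n : ℝ) ^ 4 * (16 * C * Zl 4 (δ / 2) ^ 2 * Real.exp (4 * δ)))
          * Real.exp (-(min (min (kappa163 4 / 4) κ₀ / 8) (δ / 2)) * l1 (y' - y)) :=
  mass_blk_mixOfK_K₀_le n hκ₀ hΦ (T := fun _ _ => (n : ℝ) ^ 4 * (16 * C * Zl 4 (δ / 2) ^ 2 * Real.exp (4 * δ))) hδ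
    (blockSlotTotal_le_of_locStencilFM n hM hδ).1 (blockSlotTotal_le_of_locStencilFM n hM hδ).2 μ y ν y' j i

/-! ## §3 R-T's letter shape, literally: the `ffW` block of the straight-pin mixed word and of its swap at the coarse origin -/

/-- [folklore] **THE `hWs ∕ hWm` SHAPE OF R-T `RestKernelSandwichScaled.exists_row_RkSand_tadpole_unit` FOR THE STRAIGHT-PIN MIXED WORD** (g60 FILE B §5's twin): under a
per-scale multiplier envelope `hΦ m` (the SHAPE of `exists_wΦ_decay`, `n = m + 1`) and per-scale mixed tables `M₂ n` whose ff blocks have per-slot-pair summable plain masses and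
fine-block × coarse-slot totals `≤ n^{p+13}·m̄W·e^{−θ|w − y₁|₁}` (the table author's count — NOT supplied here), the word `mixOfK (KInvStep 3 n 0) n (M₂ n) μ 0 ν z` has
`Summable (q ↦ Σ_{g f} |ffW (…) μ 0 ν z q g f|)` and `Σ'_q Σ_{g f} |ffW (…) μ 0 ν z q g f| ≤ (m+1)^p·(C^{mix}_{K₀}(θ)·m̄W)·e^{−min (m₀∕8) (θ∕2)·|z|₁}`,
`C^{mix}_{K₀}(θ) := 16·C₄e^{κ′}·CΦe^{κ₀}·e^{m₀}·e^{m₀}·Zl 4 (m₀∕8)·Zl 4 (θ∕2)` — at `p = 2` LITERALLY R-T's `hWs ∕ hWm` (`ffW_apply`, §1 `_pow` at `(tt, tt)`, `y := 0`, `y′ := z`). -/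
theorem ffW_mixOfK_K₀_rows_pow {CΦ κ₀ : ℝ} (hκ₀ : 0 < κ₀) (p : ℕ)
    {M₂ : ℕ → Fin (3 + 1) → (Fin (3 + 1) → ℤ) → Fin (3 + 1) → (Fin (3 + 1) → ℤ) → MKer 4 (Fib 3)} {θ mW : ℝ} (hθ : 0 < θ)
    (hΦ : ∀ (m : ℕ) (ρ ν : Fin (3 + 1)) (w : Fin (3 + 1) → ℤ),
      |wΦ (N := m + 1) ρ ν w| ≤ CΦ * (((m + 1 : ℕ) : ℝ) ^ 5)⁻¹ * (((m + 1 : ℕ) : ℝ) ^ 3)⁻¹ * Real.exp (-(κ₀ * supNorm w)))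
    (hPs : ∀ (m : ℕ) κ u ρ' w j i, Summable fun q : Site 4 × Site 4 => ∑ g, ∑ f, |blk (M₂ (m + 1) κ u ρ' w) j i q.1 q.2 g f|)
    (hPB : ∀ (m : ℕ) (κ ρ' : Fin (3 + 1)) (y₁ w : Fin (3 + 1) → ℤ) (j i : Bool), ∑ b ∈ box (3 + 1) (m + 1),
      (∑' q : Site 4 × Site 4, ∑ g, ∑ f, |blk (M₂ (m + 1) κ (((m + 1 : ℕ) : ℤ) • y₁ + toSite b) ρ' w) j i q.1 q.2 g f|)
        ≤ ((((m + 1 : ℕ) : ℝ)) ^ (p + 13) * mW) * Real.exp (-θ * l1 (w - y₁)))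
    (μ ν : Fin (3 + 1)) (m : ℕ) (z : Fin (3 + 1) → ℤ) :
    (Summable fun q : Site 4 × Site 4 => ∑ g, ∑ f,
        |ffW (mixOfK (KInvStep (d := 3) (m + 1) 0) (m + 1) (M₂ (m + 1))) μ 0 ν z q.1 q.2 g f|) ∧
      ∑' q : Site 4 × Site 4, ∑ g, ∑ f, |ffW (mixOfK (KInvStep (d := 3) (m + 1) 0) (m + 1) (M₂ (m + 1))) μ 0 ν z q.1 q.2 g f|
        ≤ ((m + 1 : ℕ) : ℝ) ^ p
          * ((16 * ((MG163 4 * periodConst (kappa163 4) 3) * Real.exp (kappa163 4 / 4)) * (CΦ * Real.exp κ₀)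
              * Real.exp (min (kappa163 4 / 4) κ₀) * Real.exp (min (kappa163 4 / 4) κ₀)
              * Zl 4 (min (kappa163 4 / 4) κ₀ / 8) * Zl 4 (θ / 2)) * mW)
          * Real.exp (-(min (min (kappa163 4 / 4) κ₀ / 8) (θ / 2)) * l1 z) := by
  have h := mass_blk_mixOfK_K₀_le_pow (m + 1) hκ₀ (hΦ m) p (mB := fun _ _ => mW) hθ (hPs m) (hPB m) μ 0 ν z true true
  rw [ffW_apply]
  simpa only [sub_zero, mul_assoc] using h

/-- [folklore] **THE SWAPPED WORD** `mixOfK (KInvStep 3 n 0) n (M₂ n) ν z μ 0` (the second half of the HEAD's `mixOfK K₀ M₂ + swap`) has the SAME row (`|0 − z|₁ = |z − 0|₁`, `l1_sub_symm`). -/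
theorem ffW_mixOfK_swap_K₀_rows_pow {CΦ κ₀ : ℝ} (hκ₀ : 0 < κ₀) (p : ℕ)
    {M₂ : ℕ → Fin (3 + 1) → (Fin (3 + 1) → ℤ) → Fin (3 + 1) → (Fin (3 + 1) → ℤ) → MKer 4 (Fib 3)} {θ mW : ℝ} (hθ : 0 < θ)
    (hΦ : ∀ (m : ℕ) (ρ ν : Fin (3 + 1)) (w : Fin (3 + 1) → ℤ),
      |wΦ (N := m + 1) ρ ν w| ≤ CΦ * (((m + 1 : ℕ) : ℝ) ^ 5)⁻¹ * (((m + 1 : ℕ) : ℝ) ^ 3)⁻¹ * Real.exp (-(κ₀ * supNorm w)))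
    (hPs : ∀ (m : ℕ) κ u ρ' w j i, Summable fun q : Site 4 × Site 4 => ∑ g, ∑ f, |blk (M₂ (m + 1) κ u ρ' w) j i q.1 q.2 g f|)
    (hPB : ∀ (m : ℕ) (κ ρ' : Fin (3 + 1)) (y₁ w : Fin (3 + 1) → ℤ) (j i : Bool), ∑ b ∈ box (3 + 1) (m + 1),
      (∑' q : Site 4 × Site 4, ∑ g, ∑ f, |blk (M₂ (m + 1) κ (((m + 1 : ℕ) : ℤ) • y₁ + toSite b) ρ' w) j i q.1 q.2 g f|)
        ≤ ((((m + 1 : ℕ) : ℝ)) ^ (p + 13) * mW) * Real.exp (-θ * l1 (w - y₁)))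
    (μ ν : Fin (3 + 1)) (m : ℕ) (z : Fin (3 + 1) → ℤ) :
    (Summable fun q : Site 4 × Site 4 => ∑ g, ∑ f,
        |ffW (fun μ' y ν' y' => mixOfK (KInvStep (d := 3) (m + 1) 0) (m + 1) (M₂ (m + 1)) ν' y' μ' y) μ 0 ν z q.1 q.2 g f|) ∧
      ∑' q : Site 4 × Site 4, ∑ g, ∑ f,
          |ffW (fun μ' y ν' y' => mixOfK (KInvStep (d := 3) (m + 1) 0) (m + 1) (M₂ (m + 1)) ν' y' μ' y) μ 0 ν z q.1 q.2 g f|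
        ≤ ((m + 1 : ℕ) : ℝ) ^ p
          * ((16 * ((MG163 4 * periodConst (kappa163 4) 3) * Real.exp (kappa163 4 / 4)) * (CΦ * Real.exp κ₀)
              * Real.exp (min (kappa163 4 / 4) κ₀) * Real.exp (min (kappa163 4 / 4) κ₀)
              * Zl 4 (min (kappa163 4 / 4) κ₀ / 8) * Zl 4 (θ / 2)) * mW)
          * Real.exp (-(min (min (kappa163 4 / 4) κ₀ / 8) (θ / 2)) * l1 z) := by
  have h := mass_blk_mixOfK_K₀_le_pow (m + 1) hκ₀ (hΦ m) p (mB := fun _ _ => mW) hθ (hPs m) (hPB m) ν z μ 0 true true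
  rw [ffW_apply]
  rw [ExpKernelCalculus.l1_sub_symm (0 : Fin (3 + 1) → ℤ) z, sub_zero] at h
  simpa only [mul_assoc] using h

/-- [folklore] The plain block mass of a SUM of two operators is at most the sum of the plain block masses (termwise `|a + b| ≤ |a| + |b|`; `blk` is additive by `rfl`). -/
theorem plainMass_blk_add_le {A B : MKer 4 (Fib 3)} {a b : ℝ} (j i : Bool)
    (hA : (Summable fun q : Site 4 × Site 4 => ∑ g, ∑ f, |blk A j i q.1 q.2 g f|) ∧ ∑' q : Site 4 × Site 4, ∑ g, ∑ f, |blk A j i q.1 q.2 g f| ≤ a)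
    (hB : (Summable fun q : Site 4 × Site 4 => ∑ g, ∑ f, |blk B j i q.1 q.2 g f|) ∧ ∑' q : Site 4 × Site 4, ∑ g, ∑ f, |blk B j i q.1 q.2 g f| ≤ b) :
    (Summable fun q : Site 4 × Site 4 => ∑ g, ∑ f, |blk (A + B) j i q.1 q.2 g f|) ∧
      ∑' q : Site 4 × Site 4, ∑ g, ∑ f, |blk (A + B) j i q.1 q.2 g f| ≤ a + b := by
  have hpt : ∀ q : Site 4 × Site 4, ∑ g, ∑ f, |blk (A + B) j i q.1 q.2 g f|
      ≤ (∑ g, ∑ f, |blk A j i q.1 q.2 g f|) + ∑ g, ∑ f, |blk B j i q.1 q.2 g f| := by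
    intro q
    rw [← Finset.sum_add_distrib]
    refine Finset.sum_le_sum fun g _ => ?_
    rw [← Finset.sum_add_distrib]
    refine Finset.sum_le_sum fun f _ => ?_
    exact abs_add_le _ _
  have h0 : ∀ q : Site 4 × Site 4, 0 ≤ ∑ g, ∑ f, |blk (A + B) j i q.1 q.2 g f| :=
    fun q => Finset.sum_nonneg fun g _ => Finset.sum_nonneg fun f _ => abs_nonneg _
  have hs : Summable fun q : Site 4 × Site 4 => ∑ g, ∑ f, |blk (A + B) j i q.1 q.2 g f| :=
    Summable.of_nonneg_of_le h0 hpt (hA.1.add hB.1)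
  refine ⟨hs, ?_⟩
  calc ∑' q : Site 4 × Site 4, ∑ g, ∑ f, |blk (A + B) j i q.1 q.2 g f|
      ≤ ∑' q : Site 4 × Site 4, ((∑ g, ∑ f, |blk A j i q.1 q.2 g f|) + ∑ g, ∑ f, |blk B j i q.1 q.2 g f|) :=
        hs.tsum_le_tsum hpt (hA.1.add hB.1)
    _ = (∑' q : Site 4 × Site 4, ∑ g, ∑ f, |blk A j i q.1 q.2 g f|) + ∑' q : Site 4 × Site 4, ∑ g, ∑ f, |blk B j i q.1 q.2 g f| :=
        hA.1.tsum_add hB.1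
    _ ≤ a + b := add_le_add hA.2 hB.2

/-- [folklore] **R-T's LETTER FOR THE HEAD's SYMMETRISED MIXED FAMILY** `𝒲 n μ y ν y′ := mixOfK (KInvStep 3 n 0) n (M₂ n) μ y ν y′ + mixOfK (KInvStep 3 n 0) n (M₂ n) ν y′ μ y`
(the `mixOfK K₀ M₂ + swap` of (H3-lit)'s `W^s`, AS DISPLAYED): under the hypotheses of `ffW_mixOfK_K₀_rows_pow`, `Summable` and
`Σ'_q Σ_{g f} |ffW (𝒲 (m+1)) μ 0 ν z q g f| ≤ (m+1)^p·((2·C^{mix}_{K₀}(θ))·m̄W)·e^{−min (m₀∕8) (θ∕2)·|z|₁}` — the two words' rows added (`plainMass_blk_add_le`). -/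
theorem ffW_mixOfK_symm_K₀_rows_pow {CΦ κ₀ : ℝ} (hκ₀ : 0 < κ₀) (p : ℕ)
    {M₂ : ℕ → Fin (3 + 1) → (Fin (3 + 1) → ℤ) → Fin (3 + 1) → (Fin (3 + 1) → ℤ) → MKer 4 (Fib 3)} {θ mW : ℝ} (hθ : 0 < θ)
    (hΦ : ∀ (m : ℕ) (ρ ν : Fin (3 + 1)) (w : Fin (3 + 1) → ℤ),
      |wΦ (N := m + 1) ρ ν w| ≤ CΦ * (((m + 1 : ℕ) : ℝ) ^ 5)⁻¹ * (((m + 1 : ℕ) : ℝ) ^ 3)⁻¹ * Real.exp (-(κ₀ * supNorm w)))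
    (hPs : ∀ (m : ℕ) κ u ρ' w j i, Summable fun q : Site 4 × Site 4 => ∑ g, ∑ f, |blk (M₂ (m + 1) κ u ρ' w) j i q.1 q.2 g f|)
    (hPB : ∀ (m : ℕ) (κ ρ' : Fin (3 + 1)) (y₁ w : Fin (3 + 1) → ℤ) (j i : Bool), ∑ b ∈ box (3 + 1) (m + 1),
      (∑' q : Site 4 × Site 4, ∑ g, ∑ f, |blk (M₂ (m + 1) κ (((m + 1 : ℕ) : ℤ) • y₁ + toSite b) ρ' w) j i q.1 q.2 g f|)
        ≤ ((((m + 1 : ℕ) : ℝ)) ^ (p + 13) * mW) * Real.exp (-θ * l1 (w - y₁)))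
    (μ ν : Fin (3 + 1)) (m : ℕ) (z : Fin (3 + 1) → ℤ) :
    (Summable fun q : Site 4 × Site 4 => ∑ g, ∑ f,
        |ffW (fun μ' y ν' y' => mixOfK (KInvStep (d := 3) (m + 1) 0) (m + 1) (M₂ (m + 1)) μ' y ν' y'
            + mixOfK (KInvStep (d := 3) (m + 1) 0) (m + 1) (M₂ (m + 1)) ν' y' μ' y) μ 0 ν z q.1 q.2 g f|) ∧
      ∑' q : Site 4 × Site 4, ∑ g, ∑ f,
          |ffW (fun μ' y ν' y' => mixOfK (KInvStep (d := 3) (m + 1) 0) (m + 1) (M₂ (m + 1)) μ' y ν' y'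
            + mixOfK (KInvStep (d := 3) (m + 1) 0) (m + 1) (M₂ (m + 1)) ν' y' μ' y) μ 0 ν z q.1 q.2 g f|
        ≤ ((m + 1 : ℕ) : ℝ) ^ p
          * ((2 * (16 * ((MG163 4 * periodConst (kappa163 4) 3) * Real.exp (kappa163 4 / 4)) * (CΦ * Real.exp κ₀)
              * Real.exp (min (kappa163 4 / 4) κ₀) * Real.exp (min (kappa163 4 / 4) κ₀)
              * Zl 4 (min (kappa163 4 / 4) κ₀ / 8) * Zl 4 (θ / 2))) * mW)
          * Real.exp (-(min (min (kappa163 4 / 4) κ₀ / 8) (θ / 2)) * l1 z) := by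
  have hA := ffW_mixOfK_K₀_rows_pow hκ₀ p hθ hΦ hPs hPB μ ν m z
  have hB := ffW_mixOfK_swap_K₀_rows_pow hκ₀ p hθ hΦ hPs hPB μ ν m z
  rw [ffW_apply] at hA hB ⊢
  have h := plainMass_blk_add_le true true hA hB
  refine ⟨h.1, h.2.trans (le_of_eq ?_)⟩
  ring

end Straight

end Summit.QuantumFields.BalabanUV.Beta.D1BFx.PackedStraightColumnMixedMass

end
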